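import Literature.MathematicalPhysics.QuantumFieldTheory.Balaban1983to89.Node00.Record12BgRowCoClassCPMFloorB
import Literature.MathematicalPhysics.QuantumFieldTheory.Balaban1983to89.Node00.TorusCoverGaugeTokensGuardedB
import Literature.MathematicalPhysics.QuantumFieldTheory.Balaban1983to89.Node00.Record13SignFreeComparabilityOfBetaBox
import Summits.QuantumFields.YangMills.Theorems.BalabanUVNodesN26AtRecord13BetaBoxOfDriftAtSlope

/-!
# BalabanUVNodes ∕ K0 ROAD — THE SIGN-FREE STUB 3ᴬ: K0⁷'s body from [15] Proposition 8's top step, [6] Proposition 6 at NODE 00's member, the rider `F.m ≤ 3`, and «the β-functions of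
# record of A1's witness `θ₁₅ᶜᶜᴹ(3)` are UNIFORMLY BOUNDED (two-sided, `|β| ≤ β′`) on SOME window `]0, γ₀]`» — NO SIGN OF β; and its SUPPLIER JUNCTION: NODE O's jets-free pair at the witness
# gives 3ᴬ through N26's `exists_betaBox_betaOfRecord₁₃_of_jetsFreePair` BY NAME

SIBLING MODULE (director-ym №365, R558 FINAL «RENAME-AND-REDIRECT»): this is the NEW module `K0SignFreeOfStepTokensRCubeB` (namespace `Summit.QuantumFields.YangMills.Theorems.K0SignFreeOfStepTokensRCubeB`), carrying the
Stage-2 re-keyed texts of `K0SignFreeOfStepTokensRCube` under the SAME short declaration names (every FQN new ⇒ `theorems.append-only` untouched); the old module `K0SignFreeOfStepTokensRCube` is NOT edited and becomes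
RESIDUE after the seam (R556 attic later); GREEN ON BOTH SIDES OF THE SEAM (director-ym №368 (2)): this sibling carries the SEAM-FREE 3ᴬ road of the residue module — §2's `absBetaBox_of_signBetaBox` ∕ `windowLettersBox_of_absBetaBox` ∕
`clausesH_of_absBetaBox` and §3's N26 junction `absBetaBox_of_jetsFreePair`, re-typed; NOT carried: §1's `4 ≤ F.m`-bounded closer `exists_k0H_of_prop8TopStep_of_prop6Member_of_clausesH` and the two
V17 stub-4-rider compositions `record13SepCoPHBody_of_stubsA` ∕ `…_stubs12_jetsFreePair_rider` (they read chain B's re-typed `_hcomp_cube` closer; superseded by the all-torus compositions of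
`…K0AllTorusOfStepTokensRCubeB` §1–§3; consumers = residue only) and the unused helper `exists_windowLettersBox_of_absBox` (`dedup.landed`).

STAGE-2 RE-KEY (seat `pub-ymgap-k0-s1-w3` g9, TRAIN-K0 row K0-T2 file 2∕6; director-ym №343 (D5) ∕ №346 ∕ №354; k0-s1-w1 g9 MANIFEST): (E1) Stage-2 coherence re-key to print's
(2.3) datum (FLAG №16 ∕ LOCATE-HSEAM 5d3298b8d191f169); the (b)-keyed text survives in git history.  Every displayed [15] token of this file — in hypotheses AND in the displayed stub texts —
is now the GUARDED `(bd, Dat)` ᴮ token at the cube floor guard `floorGuard F ((11·4 + 3·L)·L)` (print's «R₁M₁ sufficiently big», p.304 lines 1–2, at the collar letter of the cube witness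
`M = L³`), print's bond datum `lamDatum F` ([14] (2.3): `lamBondsSeq Ω k`) and the (7)-data predicate of record `dataSmall7PTopOf F 2` — the currency of node00-def-T's Stage-2 chain B:
Prop. 8's top step `Prop8RegSepTopStepGB F 2 suppDom (floorGuard F ((11·4+3·L)·L)) (lamDatum F) (dataSmall7PTopOf F 2) B₃ a₀ a₁` (`Node00/CriticalOnFibreTopGuardedB`), (8)
`VariationalThm1RegSepCoP7MGB F 2 (floorGuard F …) (lamDatum F) (dataSmall7PTopOf F 2) B₃ a₀ a₁` (`Record12BgRowCoClassCPMFloorB`; from the step by k0-s1-w1's 53′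
`variationalThm1RegSepCoP7MGB_of_prop8TopStepGB_lamDatum`), the (9)-step `Gauge9RegSepTopStepGB F 2 suppDom (L³) (floorGuard F …) (lamDatum F) (dataSmall7PTopOf F 2) B₃ B₃' a₀ a₁`
(`TorusCoverGaugeTokensGuardedB`; FILE C's re-keyed `gauge9R_cube_of_prop8TopStep_of_prop6Member`).  Declaration NAMES and binder ORDER unchanged (the `R` ∕ `7M` in names and the prose
«(8) ∕ the R step fact» below are historical and denote these ᴮ tokens); proofs re-sourced to chain B's re-keyed closers (same names).  Re-keying bookkeeping only — nothing of Bałaban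
asserted.  [14] = [Balaban1984PropagatorsII].

CREDIT.  The finding «THE SIGN OF β IS NOT READ BY THE K0 NODE» and this chain are node O's: ideation seat `ym-nodeO-ideate` P3 g48, memo companion
`run/shared/lean/pub/ym-nodeO-ideate/memos/lines/BetaBoxSignFree-P3g48.lean` (sha256 272e4beb1cdd2f4f…, §4b ∕ §5), EVIDENCE-N78 on the `pub-ymgap` bus 2026-08-27T19:24:46Z; plan g77
SIGNFREE-WORD 19:25Z (V17 = stub 3 ↦ 3ᴬ on this file, LANDED + BUILT).  Re-homed in the tree, `def`-free (3ᴬ and the jets-free pair are DISPLAYED hypotheses, texts verbatim), by seat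
`pub-ymgap-dag-n21-c` (g12) = FILE Cʷ′.  Consumed BY NAME: Eʷ `Node00.Record13SepCoPInhabitedOfThm1CCMWGaugeRSignFree` (`…_of_hcomp_cube`), Dʷ `Node00.Record13SignFreeComparabilityOfBetaBox`
(`exists_window_letters_signFree`, `hcompBoth_theta13OfThm1CCMW_of_betaBoxSignFree_half`), FILE C (`shrunkCeiling_pos`, `gauge9R_cube_of_prop8TopStep_of_prop6Member`), N07's bridge,
dag-n07-e's FILE 29 (`b9Of`, `a0Of`), N26 (`exists_betaBox_betaOfRecord₁₃_of_jetsFreePair`), `FlowStep.box_mono`.  `--kind proof --supports stmt-QuantumFields-20541 --as helper`.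
[15] = [Balaban1985Variational]; [6] = [Balaban1985RegularSpaces]; [III] = [Balaban1988Convergent]; [I] = [Balaban1987RG1]; [II] = [Balaban1989LargeFieldII]; [IIc] = [Balaban1988RG2Cluster]; [IV] = [Balaban1989LargeFieldI].

WHY.  V15's 3′, and Cʷ's 3ʷ ⇔ 3ˢ ⇐ 3ᵀ, all carry the SIGN `0 ≤ β` (T09.F, [II] p.355 ∕ (1.4) — UNPRINTED, idea-bound), because 13e∕A2 derived (hcomp) from monotone histories.  B′ §5's socket
reads (hcomp) ∧ (hcompRev) only, and Dʷ gets BOTH from a two-sided bound of either sign on a window small against the bound.  So stub 3 need only say «`|β₁₃(θ₁₅ᶜᶜᴹ(3))| ≤ β′` on SOME `]0, γ₀]`»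
= [I] Thm 1 p.259 ∕ §1 p.264 «uniformly bounded» (STATED in print; the content of [I] Thm 2 p.259, proof unpublished — the B12-THM2 ∕ node O (D1)+(D4) lane), and THAT text has a typed
SUPPLIER in the tree: N26's jets-free-pair lemma (K2⁗'s two stub bodies read at the record).

WHAT THIS FILE PROVES (theorems only; 0 `def`).
§1 (residue only, NOT carried here) `exists_k0H_of_prop8TopStep_of_prop6Member_of_clausesH (hm : 4 ≤ F.m) …`; its all-torus form (no `hm`) is `…K0AllTorusOfStepTokensRCubeB` §1.
§2 3ᴬ AND ITS ROAD (texts spelled out, no `def`): `absBetaBox_of_signBetaBox` (Cʷ's 3ˢ ⇒ 3ᴬ — so V16's stub by name stays un-refuted), `windowLettersBox_of_absBetaBox` (3ᴬ ⇒ the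
   windowed two-sided box with letters on a shrunk `γ ≤ ½`, Dʷ §0), ★★ `clausesH_of_absBetaBox` (3ᴬ ⇒ the sign-free clause form at `θ₁₅ᶜᶜᴹ(3; γ)`); the residue's V17 composition `record13SepCoPHBody_of_stubsA
   (h1) (h2) (h3A) (h4)` is NOT carried here (see SIBLING MODULE above; the all-torus composition lives in `…K0AllTorusOfStepTokensRCubeB`).
§3 THE SUPPLIER SIDE: ★★ `absBetaBox_of_jetsFreePair` (NODE O's jets-free pair at `θ₁₅ᶜᶜᴹ(3)` for every guarded tuple ⟹ 3ᴬ; N26 BY NAME); the residue's helper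
   `exists_windowLettersBox_of_absBox` and rider composition `record13SepCoPHBody_of_stubs12_jetsFreePair_rider` are NOT carried here.
CHAIN: 3′ ⇒ 3ʷ ⇔ 3ˢ ⇒ 3ᴬ ⇐ jets-free pair; every step a weakening; nothing refuted.

HONEST FRAMING.  Compositions of tree theorems + Dʷ's window arithmetic; CONDITIONAL on [15] Prop. 8's top step (N07), [6] Prop. 6 at the member (N05), 3ᴬ resp. the jets-free pair (NODE O ∕
K2⁗'s (D1)+(D4) at one record — NOT proved), the rider and the signs — all DISPLAYED hypotheses, never asserted; NO sign of β derived or assumed anywhere (T09.F stands, for the flow ∕ K2 side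
where it is read); nothing of Bałaban asserted or discharged; K0⁷ ∕ K2⁷ OPEN; V16 is the skeleton OF RECORD — 3ᴬ is the plan's announced V17 re-cut, not a re-registration by this seat;
counts unmoved (typed 28∕28 · discharged 5∕27); one finite 𝕋⁴ programme at fixed ε — NOT continuum ∕ OS ∕ mass gap ∕ Clay.  No `sorry`, `def`, `instance`, `notation`.
-/

noncomputable section

open scoped Matrix.Norms.L2Operator

namespace Summit.QuantumFields.YangMills.Theorems.K0SignFreeOfStepTokensRCubeB

open Literature.MathematicalPhysics.QuantumFieldTheory.Balaban1983to89
open Literature.MathematicalPhysics.QuantumFieldTheory.Balaban1983to89.Node00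
open Literature.MathematicalPhysics.QuantumFieldTheory.Balaban1983to89.T4Continuum
open Literature.MathematicalPhysics.QuantumFieldTheory.Balaban1983to89.FlowStep
open Literature.MathematicalPhysics.QuantumFieldTheory.Balaban1983to89.Beta.Drift (OneLoopDrift)
open Summit.QuantumFields.BalabanUV.Gaps.BetaContFromD4Chain (AtSlopeCont)
open Summit.QuantumFields.YangMills.Theorems.BalabanUVNodesN26AtRecord13BetaBoxOfDriftAtSlope (exists_betaBox_betaOfRecord₁₃_of_jetsFreePair)

/-! ## §2. 3ᴬ — «`|β₁₃(θ₁₅ᶜᶜᴹ(3))| ≤ β′` on SOME window» — and its road to K0⁷'s body (texts spelled out; no `def`) -/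

section SignFree

/-- **3ˢ ⟹ 3ᴬ AT `F`** (Cʷ's sign-stub text, displayed verbatim as the hypothesis, implies the sign-free text: `β″ := max β′ 0`) — so 3ᴬ is WEAKER than each of 3′ ⇒ 3ʷ ⇔ 3ˢ ⇐ 3ᵀ and V16's
registered stub implies V17's by name.  (node O P3 g48 §4b.) [cite: Balaban1987RG1, §1 p.264 (bookkeeping)] -/
theorem absBetaBox_of_signBetaBox (F : T4Family)
    (h3S : ∀ B₃ B₃' a₀ a₁ : ℝ, 2 * (F.L : ℝ) ^ 2 ≤ B₃ → 0 < B₃' → 0 < a₀ → 0 < a₁ →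
      VariationalThm1RegSepCoP7MGB F 2 (floorGuard F ((11 * 4 + 3 * F.L) * F.L)) (lamDatum F) (dataSmall7PTopOf F 2) B₃ a₀ a₁ →
      Gauge9RegSepTopStepGB F 2 (fun ν K Ω => suppDomOfRecord F ν K Ω) (F.L ^ 3) (floorGuard F ((11 * 4 + 3 * F.L) * F.L)) (lamDatum F) (dataSmall7PTopOf F 2) B₃ B₃' a₀ a₁ →
      ∃ γ₀ ε₀ ε₂₉ β' : ℝ, 0 < γ₀ ∧ 0 < ε₀ ∧ 0 < ε₂₉ ∧
        BetaLowerH 0 γ₀ (betaOfRecord₁₃ F 2 (theta13OfThm1CCM F 2 3 ε₀ ε₂₉ B₃ B₃' a₀ a₁)) ∧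
        BetaUpperH β' γ₀ (betaOfRecord₁₃ F 2 (theta13OfThm1CCM F 2 3 ε₀ ε₂₉ B₃ B₃' a₀ a₁))) :
    ∀ B₃ B₃' a₀ a₁ : ℝ, 2 * (F.L : ℝ) ^ 2 ≤ B₃ → 0 < B₃' → 0 < a₀ → 0 < a₁ →
      VariationalThm1RegSepCoP7MGB F 2 (floorGuard F ((11 * 4 + 3 * F.L) * F.L)) (lamDatum F) (dataSmall7PTopOf F 2) B₃ a₀ a₁ →
      Gauge9RegSepTopStepGB F 2 (fun ν K Ω => suppDomOfRecord F ν K Ω) (F.L ^ 3) (floorGuard F ((11 * 4 + 3 * F.L) * F.L)) (lamDatum F) (dataSmall7PTopOf F 2) B₃ B₃' a₀ a₁ →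
      ∃ γ₀ ε₀ ε₂₉ β' : ℝ, 0 < γ₀ ∧ 0 < ε₀ ∧ 0 < ε₂₉ ∧
        BetaLowerH (-β') γ₀ (betaOfRecord₁₃ F 2 (theta13OfThm1CCM F 2 3 ε₀ ε₂₉ B₃ B₃' a₀ a₁)) ∧
        BetaUpperH β' γ₀ (betaOfRecord₁₃ F 2 (theta13OfThm1CCM F 2 3 ε₀ ε₂₉ B₃ B₃' a₀ a₁)) := by
  intro B₃ B₃' a₀ a₁ hB₃ hB₃' ha₀ ha₁ h15 h9
  obtain ⟨γ₀, ε₀, ε₂₉, β', hγ0, hε, hε', hlow, hup⟩ := h3S B₃ B₃' a₀ a₁ hB₃ hB₃' ha₀ ha₁ h15 h9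
  refine ⟨γ₀, ε₀, ε₂₉, max β' 0, hγ0, hε, hε', fun k v hv => ?_, fun k v hv => (hup k v hv).trans (le_max_left _ _)⟩
  have h0 : -(max β' 0) ≤ 0 := neg_nonpos.mpr (le_max_right _ _)
  exact h0.trans (hlow k v hv)

/-- **3ᴬ ⟹ THE WINDOWED TWO-SIDED BOX WITH LETTERS AT `F`**: the abs box on some window gives, on a shrunk window `γ ≤ ½` (Dʷ §0), the two-sided box of A1's witness with `−bₗ·γ² ≤ 3`,
`β′·γ² ≤ ¾` (`bₗ := −β′`; `0 ≤ β′` is read off the non-empty box `]0, γ₀]^1`) — Eʷ's `_betaBoxSignFree_half_cube` hypotheses.  (node O P3 g48 §4b.) [cite: Balaban1987RG1, §1 p.264 (bookkeeping)] -/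
theorem windowLettersBox_of_absBetaBox (F : T4Family)
    (h3A : ∀ B₃ B₃' a₀ a₁ : ℝ, 2 * (F.L : ℝ) ^ 2 ≤ B₃ → 0 < B₃' → 0 < a₀ → 0 < a₁ →
      VariationalThm1RegSepCoP7MGB F 2 (floorGuard F ((11 * 4 + 3 * F.L) * F.L)) (lamDatum F) (dataSmall7PTopOf F 2) B₃ a₀ a₁ →
      Gauge9RegSepTopStepGB F 2 (fun ν K Ω => suppDomOfRecord F ν K Ω) (F.L ^ 3) (floorGuard F ((11 * 4 + 3 * F.L) * F.L)) (lamDatum F) (dataSmall7PTopOf F 2) B₃ B₃' a₀ a₁ →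
      ∃ γ₀ ε₀ ε₂₉ β' : ℝ, 0 < γ₀ ∧ 0 < ε₀ ∧ 0 < ε₂₉ ∧
        BetaLowerH (-β') γ₀ (betaOfRecord₁₃ F 2 (theta13OfThm1CCM F 2 3 ε₀ ε₂₉ B₃ B₃' a₀ a₁)) ∧
        BetaUpperH β' γ₀ (betaOfRecord₁₃ F 2 (theta13OfThm1CCM F 2 3 ε₀ ε₂₉ B₃ B₃' a₀ a₁))) :
    ∀ B₃ B₃' a₀ a₁ : ℝ, 2 * (F.L : ℝ) ^ 2 ≤ B₃ → 0 < B₃' → 0 < a₀ → 0 < a₁ →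
      VariationalThm1RegSepCoP7MGB F 2 (floorGuard F ((11 * 4 + 3 * F.L) * F.L)) (lamDatum F) (dataSmall7PTopOf F 2) B₃ a₀ a₁ →
      Gauge9RegSepTopStepGB F 2 (fun ν K Ω => suppDomOfRecord F ν K Ω) (F.L ^ 3) (floorGuard F ((11 * 4 + 3 * F.L) * F.L)) (lamDatum F) (dataSmall7PTopOf F 2) B₃ B₃' a₀ a₁ →
      ∃ γ ε₀ ε₂₉ bl β' : ℝ, 0 < γ ∧ γ ≤ 1 / 2 ∧ 0 < ε₀ ∧ 0 < ε₂₉ ∧ -bl * γ ^ 2 ≤ 3 ∧ β' * γ ^ 2 ≤ 3 / 4 ∧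
        BetaLowerH bl γ (betaOfRecord₁₃ F 2 (theta13OfThm1CCM F 2 3 ε₀ ε₂₉ B₃ B₃' a₀ a₁)) ∧
        BetaUpperH β' γ (betaOfRecord₁₃ F 2 (theta13OfThm1CCM F 2 3 ε₀ ε₂₉ B₃ B₃' a₀ a₁)) := by
  intro B₃ B₃' a₀ a₁ hB₃ hB₃' ha₀ ha₁ h15 h9
  obtain ⟨γ₀, ε₀, ε₂₉, β', hγ0, hε, hε', hlow, hup⟩ := h3A B₃ B₃' a₀ a₁ hB₃ hB₃' ha₀ ha₁ h15 h9
  have hv : (fun _ : Fin (0 + 1) => γ₀) ∈ Box γ₀ 0 := mem_box.mpr fun _ => ⟨hγ0, le_rfl⟩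
  have hβ' : 0 ≤ β' := by
    have h1 := hlow 0 _ hv
    have h2 := hup 0 _ hv
    linarith
  obtain ⟨γ, hγpos, hγle, hγhalf, hl, hu⟩ := exists_window_letters_signFree hγ0 hβ'
  exact ⟨γ, ε₀, ε₂₉, -β', β', hγpos, hγhalf, hε, hε', hl, hu,
    fun k v hv => hlow k v (box_mono hγle k hv), fun k v hv => hup k v (box_mono hγle k hv)⟩

/-- **★★ 3ᴬ ⟹ 3ᶜʰ, THE SIGN-FREE CLAUSE FORM AT THE WINDOW EDITION**: for every guarded constants tuple carrying (8) and the R step fact, SOME window `γ ∈ ]0, ½]` and thresholds `ε₀, ε₂₉ > 0` with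
(hcomp) ∧ (hcompRev) along every `γ`-windowed run of `θ₁₅ᶜᶜᴹ(3; γ)` (Dʷ ★★ʷ ∘ `windowLettersBox_of_absBetaBox`).  CONDITIONAL on 3ᴬ.  (node O P3 g48 §4b.)
[cite: Balaban1987RG1, Thm 1 p.259, (0.20) p.256, (1.20)–(1.22) p.264, §1 p.264; Balaban1988Convergent, (2.4)–(2.8) pp.255–256] -/
theorem clausesH_of_absBetaBox (F : T4Family)
    (h3A : ∀ B₃ B₃' a₀ a₁ : ℝ, 2 * (F.L : ℝ) ^ 2 ≤ B₃ → 0 < B₃' → 0 < a₀ → 0 < a₁ →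
      VariationalThm1RegSepCoP7MGB F 2 (floorGuard F ((11 * 4 + 3 * F.L) * F.L)) (lamDatum F) (dataSmall7PTopOf F 2) B₃ a₀ a₁ →
      Gauge9RegSepTopStepGB F 2 (fun ν K Ω => suppDomOfRecord F ν K Ω) (F.L ^ 3) (floorGuard F ((11 * 4 + 3 * F.L) * F.L)) (lamDatum F) (dataSmall7PTopOf F 2) B₃ B₃' a₀ a₁ →
      ∃ γ₀ ε₀ ε₂₉ β' : ℝ, 0 < γ₀ ∧ 0 < ε₀ ∧ 0 < ε₂₉ ∧
        BetaLowerH (-β') γ₀ (betaOfRecord₁₃ F 2 (theta13OfThm1CCM F 2 3 ε₀ ε₂₉ B₃ B₃' a₀ a₁)) ∧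
        BetaUpperH β' γ₀ (betaOfRecord₁₃ F 2 (theta13OfThm1CCM F 2 3 ε₀ ε₂₉ B₃ B₃' a₀ a₁))) :
    ∀ B₃ B₃' a₀ a₁ : ℝ, 2 * (F.L : ℝ) ^ 2 ≤ B₃ → 0 < B₃' → 0 < a₀ → 0 < a₁ →
      VariationalThm1RegSepCoP7MGB F 2 (floorGuard F ((11 * 4 + 3 * F.L) * F.L)) (lamDatum F) (dataSmall7PTopOf F 2) B₃ a₀ a₁ →
      Gauge9RegSepTopStepGB F 2 (fun ν K Ω => suppDomOfRecord F ν K Ω) (F.L ^ 3) (floorGuard F ((11 * 4 + 3 * F.L) * F.L)) (lamDatum F) (dataSmall7PTopOf F 2) B₃ B₃' a₀ a₁ →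
      ∃ γ ε₀ ε₂₉ : ℝ, 0 < γ ∧ γ ≤ 1 / 2 ∧ 0 < ε₀ ∧ 0 < ε₂₉ ∧
        (∀ (p : B12.RunParams) (n : ℕ), n ≤ p.K → Step.InInterval (theta13OfThm1CCMW F 2 3 γ ε₀ ε₂₉ B₃ B₃' a₀ a₁).γ n (gOfRecord₁₃ F 2 (theta13OfThm1CCMW F 2 3 γ ε₀ ε₂₉ B₃ B₃' a₀ a₁) p) → ∀ m, m < n →
          (theta13OfThm1CCMW F 2 3 γ ε₀ ε₂₉ B₃ B₃' a₀ a₁).s2.cR * epsOfRecord (theta13OfThm1CCMW F 2 3 γ ε₀ ε₂₉ B₃ B₃' a₀ a₁).ν (gOfRecord₁₃ F 2 (theta13OfThm1CCMW F 2 3 γ ε₀ ε₂₉ B₃ B₃' a₀ a₁) p) m ≤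
            2 * ((theta13OfThm1CCMW F 2 3 γ ε₀ ε₂₉ B₃ B₃' a₀ a₁).s2.cR * epsOfRecord (theta13OfThm1CCMW F 2 3 γ ε₀ ε₂₉ B₃ B₃' a₀ a₁).ν (gOfRecord₁₃ F 2 (theta13OfThm1CCMW F 2 3 γ ε₀ ε₂₉ B₃ B₃' a₀ a₁) p) (m + 1))) ∧
        (∀ (p : B12.RunParams) (n : ℕ), n ≤ p.K → Step.InInterval (theta13OfThm1CCMW F 2 3 γ ε₀ ε₂₉ B₃ B₃' a₀ a₁).γ n (gOfRecord₁₃ F 2 (theta13OfThm1CCMW F 2 3 γ ε₀ ε₂₉ B₃ B₃' a₀ a₁) p) → ∀ m, m < n →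
          (theta13OfThm1CCMW F 2 3 γ ε₀ ε₂₉ B₃ B₃' a₀ a₁).s2.cR * epsOfRecord (theta13OfThm1CCMW F 2 3 γ ε₀ ε₂₉ B₃ B₃' a₀ a₁).ν (gOfRecord₁₃ F 2 (theta13OfThm1CCMW F 2 3 γ ε₀ ε₂₉ B₃ B₃' a₀ a₁) p) (m + 1) ≤
            2 * ((theta13OfThm1CCMW F 2 3 γ ε₀ ε₂₉ B₃ B₃' a₀ a₁).s2.cR * epsOfRecord (theta13OfThm1CCMW F 2 3 γ ε₀ ε₂₉ B₃ B₃' a₀ a₁).ν (gOfRecord₁₃ F 2 (theta13OfThm1CCMW F 2 3 γ ε₀ ε₂₉ B₃ B₃' a₀ a₁) p) m)) := by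
  intro B₃ B₃' a₀ a₁ hB₃ hB₃' ha₀ ha₁ h15 h9
  obtain ⟨γ, ε₀, ε₂₉, bl, β', hγ0, hγ, hε, hε', hl, hu, hlow, hup⟩ := windowLettersBox_of_absBetaBox F h3A B₃ B₃' a₀ a₁ hB₃ hB₃' ha₀ ha₁ h15 h9
  have hL : (0 : ℝ) < (F.L : ℝ) := by exact_mod_cast lt_trans Nat.zero_lt_one F.hL.2
  have hB : (0 : ℝ) ≤ B₃ := (mul_pos two_pos (pow_pos hL 2)).le.trans hB₃
  exact ⟨γ, ε₀, ε₂₉, hγ0, hγ, hε, hε', hcompBoth_theta13OfThm1CCMW_of_betaBoxSignFree_half hγ hB hB₃'.le ha₀.le ha₁.le hlow hup hl hu⟩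

end SignFree

/-! ## §3. THE SUPPLIER SIDE: NODE O's jets-free pair at a record gives the abs box (N26 BY NAME), hence 3ᴬ at A1's witness, hence K0⁷'s body end to end -/

section Supplier

variable {F : T4Family} {N : ℕ} [NeZero N]

/-- **★★ THE JUNCTION, N26 BY NAME — NODE O's JETS-FREE PAIR AT A1's WITNESS `θ₁₅ᶜᶜᴹ(3)`, for every guarded constants tuple carrying (8) and the R step fact, at SOME thresholds `ε₀, ε₂₉ > 0`,
SUPPLIES 3ᴬ** («`∃ d ≥ 0, A, OneLoopDrift d A β⁰_θ ∧ ∃ γ₀ ∈ ]0, θ.γ], AtSlopeCont (split₁₃ θ) γ₀ d`» at `θ = θ₁₅ᶜᶜᴹ(3; ε₀, ε₂₉; …)` — the hypothesis of N26's `exists_betaBox_betaOfRecord₁₃_of_jetsFreePair`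
VERBATIM, = dag-n26-c's `registeredPair₁₃_iff_jetsFreePair` right-hand side = K2⁗'s two stub bodies read at that record).  This is the supplier ∕ consumer junction the signed texts 3′∕3ʷ∕3ˢ∕3ᵀ do
not have.  CONDITIONAL on the pair; NOT proved; no sign; nothing of Bałaban asserted.  (node O P3 g48 §5.) [cite: Balaban1987RG1, Thm 2 p.259, §1 p.264, (2.12)–(2.14) p.268, (5.10) p.293; Balaban1988RG2Cluster, Lemma 3 (2.38) p.20; Balaban1985Variational, Thm 1 p.279, Prop. 8 p.304] -/
theorem absBetaBox_of_jetsFreePair (F : T4Family)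
    (h : ∀ B₃ B₃' a₀ a₁ : ℝ, 2 * (F.L : ℝ) ^ 2 ≤ B₃ → 0 < B₃' → 0 < a₀ → 0 < a₁ →
      VariationalThm1RegSepCoP7MGB F 2 (floorGuard F ((11 * 4 + 3 * F.L) * F.L)) (lamDatum F) (dataSmall7PTopOf F 2) B₃ a₀ a₁ →
      Gauge9RegSepTopStepGB F 2 (fun ν K Ω => suppDomOfRecord F ν K Ω) (F.L ^ 3) (floorGuard F ((11 * 4 + 3 * F.L) * F.L)) (lamDatum F) (dataSmall7PTopOf F 2) B₃ B₃' a₀ a₁ →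
      ∃ ε₀ ε₂₉ : ℝ, 0 < ε₀ ∧ 0 < ε₂₉ ∧
        (letI := (theta13OfThm1CCM F 2 3 ε₀ ε₂₉ B₃ B₃' a₀ a₁).instVβ₁; letI := (theta13OfThm1CCM F 2 3 ε₀ ε₂₉ B₃ B₃' a₀ a₁).instVβ₂;
         letI := (theta13OfThm1CCM F 2 3 ε₀ ε₂₉ B₃ B₃' a₀ a₁).instιβ
         ∃ d A : ℝ, 0 ≤ d ∧
           OneLoopDrift d A (beta0OfMerged (betaMerged F (mergedTermFamilyMatT F 2 (TcanOfRecord F 2)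
             (chiFixed29 F 2 (theta13OfThm1CCM F 2 3 ε₀ ε₂₉ B₃ B₃' a₀ a₁).ν (theta13OfThm1CCM F 2 3 ε₀ ε₂₉ B₃ B₃' a₀ a₁).ε₂₉) (theta13OfThm1CCM F 2 3 ε₀ ε₂₉ B₃ B₃' a₀ a₁).εbg)
             (theta13OfThm1CCM F 2 3 ε₀ ε₂₉ B₃ B₃' a₀ a₁).ρ8 (theta13OfThm1CCM F 2 3 ε₀ ε₂₉ B₃ B₃' a₀ a₁).bV) (theta13OfThm1CCM F 2 3 ε₀ ε₂₉ B₃ B₃' a₀ a₁).v₀) ∧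
           ∃ γ₀ : ℝ, 0 < γ₀ ∧ γ₀ ≤ (theta13OfThm1CCM F 2 3 ε₀ ε₂₉ B₃ B₃' a₀ a₁).γ ∧
             AtSlopeCont
               (oneLoopSplit_betaOfMerged
                 (betaMerged F (mergedTermFamilyMatT F 2 (TcanOfRecord F 2)
                   (chiFixed29 F 2 (theta13OfThm1CCM F 2 3 ε₀ ε₂₉ B₃ B₃' a₀ a₁).ν (theta13OfThm1CCM F 2 3 ε₀ ε₂₉ B₃ B₃' a₀ a₁).ε₂₉) (theta13OfThm1CCM F 2 3 ε₀ ε₂₉ B₃ B₃' a₀ a₁).εbg)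
                   (theta13OfThm1CCM F 2 3 ε₀ ε₂₉ B₃ B₃' a₀ a₁).ρ8 (theta13OfThm1CCM F 2 3 ε₀ ε₂₉ B₃ B₃' a₀ a₁).bV)
                 (beta0OfMerged (betaMerged F (mergedTermFamilyMatT F 2 (TcanOfRecord F 2)
                   (chiFixed29 F 2 (theta13OfThm1CCM F 2 3 ε₀ ε₂₉ B₃ B₃' a₀ a₁).ν (theta13OfThm1CCM F 2 3 ε₀ ε₂₉ B₃ B₃' a₀ a₁).ε₂₉) (theta13OfThm1CCM F 2 3 ε₀ ε₂₉ B₃ B₃' a₀ a₁).εbg)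
                   (theta13OfThm1CCM F 2 3 ε₀ ε₂₉ B₃ B₃' a₀ a₁).ρ8 (theta13OfThm1CCM F 2 3 ε₀ ε₂₉ B₃ B₃' a₀ a₁).bV) (theta13OfThm1CCM F 2 3 ε₀ ε₂₉ B₃ B₃' a₀ a₁).v₀)
                 (theta13OfThm1CCM F 2 3 ε₀ ε₂₉ B₃ B₃' a₀ a₁).γ)
               γ₀ d)) :
    ∀ B₃ B₃' a₀ a₁ : ℝ, 2 * (F.L : ℝ) ^ 2 ≤ B₃ → 0 < B₃' → 0 < a₀ → 0 < a₁ →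
      VariationalThm1RegSepCoP7MGB F 2 (floorGuard F ((11 * 4 + 3 * F.L) * F.L)) (lamDatum F) (dataSmall7PTopOf F 2) B₃ a₀ a₁ →
      Gauge9RegSepTopStepGB F 2 (fun ν K Ω => suppDomOfRecord F ν K Ω) (F.L ^ 3) (floorGuard F ((11 * 4 + 3 * F.L) * F.L)) (lamDatum F) (dataSmall7PTopOf F 2) B₃ B₃' a₀ a₁ →
      ∃ γ₀ ε₀ ε₂₉ β' : ℝ, 0 < γ₀ ∧ 0 < ε₀ ∧ 0 < ε₂₉ ∧
        BetaLowerH (-β') γ₀ (betaOfRecord₁₃ F 2 (theta13OfThm1CCM F 2 3 ε₀ ε₂₉ B₃ B₃' a₀ a₁)) ∧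
        BetaUpperH β' γ₀ (betaOfRecord₁₃ F 2 (theta13OfThm1CCM F 2 3 ε₀ ε₂₉ B₃ B₃' a₀ a₁)) := by
  intro B₃ B₃' a₀ a₁ hB₃ hB₃' ha₀ ha₁ h15 h9
  obtain ⟨ε₀, ε₂₉, hε, hε', hJ⟩ := h B₃ B₃' a₀ a₁ hB₃ hB₃' ha₀ ha₁ h15 h9
  obtain ⟨γ₀, hγ0, -, β', -, hup, hlow, -⟩ := exists_betaBox_betaOfRecord₁₃_of_jetsFreePair F 2 (theta13OfThm1CCM F 2 3 ε₀ ε₂₉ B₃ B₃' a₀ a₁) hJ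
  exact ⟨γ₀, ε₀, ε₂₉, β', hγ0, hε, hε', hlow, hup⟩

end Supplier

end Summit.QuantumFields.YangMills.Theorems.K0SignFreeOfStepTokensRCubeB

end
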